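import Mathlib
import Summits.KontsevichZagierPeriods.Zeta5Search.DenomLaw.VGainCoverKit
import Summits.KontsevichZagierPeriods.Zeta5Search.DenomLaw.LawZL5CoverKit
import Summits.KontsevichZagierPeriods.Zeta5Search.CasoratianBoundPalV
import HarnessLib

/-!
# ζ(5) search — the V-GAIN COVER KIT WITH PALINDROMIC ROWS (the census's `VGP` rung in cover form) (DENOM-LAW D1, prover-d1 gen 23)

Cell `pub-zeta5` (HONEST FRAMING: systematic search; no irrationality claim unless certified), TRACK «DENOM-LAW» D1 prover seat
(denom-prover-d1 gen 23, `HOME/denom-law/prover-d1/ATTEMPT-23.md`).  gen 23's `VGainCoverKit` (`v_p(V(b)), v_p(V(b+e_j)) ≥ 1 − N` when the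
only non-tame classes of exponent `≤ −N` are centre-free palindromic classes at `−N`, `N` even) combined with gen 19's THEOREM LB♯ rows
(`cas_val_ge_of_coeffV_pal`: a DROPPED multipole class — centre-free, palindromic, `E ≤ −3`, `3 + E` odd — contributes the row `4 + E` instead of
`3 + E`) read off the cover by gen 21's `rowsPal_of_cover`: **`v_p(Cas_j(b)) ≥ (1 − N) + (R if p ≤ d, else min R 0)`** for any `R ≤ 1` passing the
palindromic row check on the type list (`vgainPal_of_cover`).  First consumer: the a = 6 profile A6U47 (long pair blocks `(i,7)` and the pairs
within `{4,5,6}`; `DenomLaw/ProfileA6u47Path`), where the deep multipole type `[1,−3,−3,1]` (`E = −4`) is dropped (row `0`, not `−1`).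
`p`-adic valuations of the cell's own rationals; nothing about ζ(5); no γ; records in print UNMOVED.
-/

noncomputable section

open Finset

namespace Summit.KontsevichZagierPeriods.Zeta5Search.DenomLaw

open Summit.KontsevichZagierPeriods.Zeta5Search.ClusterValuation
open Summit.KontsevichZagierPeriods.Zeta5Search.WedgeDictionary (coeffV dOf)
open Summit.KontsevichZagierPeriods.Zeta5Search.CasoratianValuation (InPolytope shift casoratian)
open Summit.KontsevichZagierPeriods.Zeta5Search.BigPrime (shift_zero)
open Summit.KontsevichZagierPeriods.Zeta5Search.PadicSeries
open Summit.KontsevichZagierPeriods.Zeta5Search.ClassTypeCover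

variable {p : ℕ} [hp : Fact p.Prime]

/-- **The V-gain with palindromic rows, any even depth `N ≥ 1`, any `d`, any direction `j`.** -/
theorem vgainPal_anyDepth (b : ℕ → ℤ) (j : ℕ) (hb : InPolytope b) (hb' : InPolytope (shift b j)) (hj1 : 1 ≤ j) (hj7 : j ≤ 7)
    (hp5 : 5 ≤ p) (hpb : (p : ℤ) ≤ b 0) (hwin : (b 0 + 2 : ℤ) < (p : ℤ) ^ 2) {N : ℕ} (hN : 1 ≤ N) (hNe : Even N)
    (hT : ∀ x, x < p → classExp b p x < -(N : ℤ) → classPoleCount b p x = 1 ∧ tameSingle b p x = true)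
    (hD : ∀ x ∈ deepClasses b p N, (classPoleCount b p x = 1 ∧ tameSingle b p x = true) ∨
      (¬ CentreIn b p x ∧ (∀ s ∈ classSet b p x, netExp b s = netExp b ((b 0).toNat - ((b 0).toNat - x) % p - (s - x)))))
    (R : ℤ) (hR1 : R ≤ 1)
    (hRm : ∀ x, x < p → 2 ≤ classPoleCount b p x → R ≤ 3 + classExp b p x ∨
      (classExp b p x ≤ -3 ∧ IsPalindromic (classConfig b p x) ∧ Odd (3 + classExp b p x) ∧ R ≤ 4 + classExp b p x))
    (hcas : casoratian b j ≠ 0) :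
    (1 - (N : ℤ)) + (if (p : ℤ) ≤ dOf b then R else min R 0) ≤ padicValRat p (casoratian b j) := by
  have hp0 : 0 < p := hp.out.pos
  have h0 : 0 ≤ b 0 := hb.1.1
  have hpn : p ≤ (b 0).toNat := by
    have : (((b 0).toNat : ℕ) : ℤ) = b 0 := Int.toNat_of_nonneg h0
    omega
  have hwin' : (shift b j 0 + 2 : ℤ) < (p : ℤ) ^ 2 := by rwa [shift_zero b hj1]
  have hpn' : p ≤ (shift b j 0).toNat := by rwa [shift_zero b hj1]
  have hHb := ddHyp_self b hT hD
  have hHb' := ddHyp_shift b hb hj1 hp0 hT hD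
  have hV := padicNorm_coeffV_le_ddTwo b hb hp5 hpn hwin hN hNe hHb
  have hV' := padicNorm_coeffV_le_ddTwo (shift b j) hb' hp5 hpn' hwin' hN hNe hHb'
  have hle : (if (p : ℤ) ≤ dOf b then R else min R 0) ≤ R := by
    split_ifs
    · exact le_rfl
    · exact min_le_left _ _
  refine cas_val_ge_of_coeffV_pal b j p hb hj1 hj7 hb' hp.out hp5 hpb hwin (1 - (N : ℤ)) _ hV hV' ?_ ?_ ?_ hcas
  · intro x _ _; exact hle.trans hR1
  · intro x hx h2
    rcases hRm x hx h2 with h | ⟨h1, h2', h3, h4⟩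
    · exact Or.inl (hle.trans h)
    · exact Or.inr ⟨h1, h2', h3, hle.trans h4⟩
  · intro hd
    rw [if_neg (by push Not; exact hd)]
    exact min_le_right _ _

/-- **The V-gain with palindromic rows from a cover**: gen 10's `checkB` at `N` and gen 21's palindromic row check on the type list. -/
theorem vgainPal_of_cover {b : ℕ → ℤ} {j : ℕ} (hb : InPolytope b) (hj1 : 1 ≤ j) (hj7 : j ≤ 7)
    (hb' : InPolytope (shift b j)) (hp5 : 5 ≤ p) (hpb : (p : ℤ) ≤ b 0)
    (hwin : (b 0 + 2 : ℤ) < (p : ℤ) ^ 2) {TY : List (List ℤ × Bool)} (hcov : Cover b p TY) {N : ℕ} (hN : 1 ≤ N) (hNe : Even N)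
    (hchk : checkB (decide (¬ (2 : ℤ) ∣ b 0)) TY N = true) (R : ℤ) (hR1 : R ≤ 1)
    (hrows : (TY.all fun tc => decide (polesL tc.1 < 2) ||
      (decide (R ≤ 3 + expL (decide (¬ (2 : ℤ) ∣ b 0)) tc.1 tc.2) ||
        (!tc.2 && decide (tc.1.reverse = tc.1) && decide (expL (decide (¬ (2 : ℤ) ∣ b 0)) tc.1 tc.2 ≤ -3) &&
          decide (Even (expL (decide (¬ (2 : ℤ) ∣ b 0)) tc.1 tc.2)) && decide (R ≤ 4 + expL (decide (¬ (2 : ℤ) ∣ b 0)) tc.1 tc.2)))) = true)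
    (hcas : casoratian b j ≠ 0) :
    (1 - (N : ℤ)) + (if (p : ℤ) ≤ dOf b then R else min R 0) ≤ padicValRat p (casoratian b j) := by
  rw [checkB, List.all_eq_true] at hchk
  refine vgainPal_anyDepth b j hb hb' hj1 hj7 hp5 hpb hwin hN hNe ?_ ?_ R hR1 (rowsPal_of_cover hpb hcov hrows) hcas
  · intro x hx hE
    obtain ⟨tc, htc, ht⟩ := hcov x hx
    have hc0 := hchk tc htc
    simp only [Bool.or_eq_true, Bool.not_eq_true', decide_eq_false_iff_not, Bool.and_eq_true,
      decide_eq_true_eq] at hc0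
    have hc := hc0.1
    rw [ht.classExp_eq] at hE
    rw [ht.classPoleCount_eq, ht.tameSingle_eq]
    rcases hc with h | h
    · exact absurd hE h
    · exact h
  · intro x hxd
    obtain ⟨hx, hE⟩ := (mem_deepClasses_iff b p N x).1 hxd
    obtain ⟨tc, htc, ht⟩ := hcov x hx
    have hc0 := hchk tc htc
    simp only [Bool.or_eq_true, Bool.not_eq_true', decide_eq_false_iff_not, Bool.and_eq_true,
      decide_eq_true_eq] at hc0
    have hc := hc0.2
    rw [ht.classExp_eq] at hE
    rcases hc with h | h | ⟨hc1, hc2⟩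
    · exact absurd hE h
    · left; rw [ht.classPoleCount_eq, ht.tameSingle_eq]; exact h
    · right
      refine ⟨fun hcen => ?_, ht.pal_classSet hc2⟩
      have := ht.cen_iff.1 hcen
      rw [this] at hc1
      exact Bool.noConfusion hc1

end Summit.KontsevichZagierPeriods.Zeta5Search.DenomLaw

end
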